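import Literature.NumberTheory.EllipticCurves.WeilPairingProofs
import Literature.NumberTheory.EllipticCurves.TateModule
import Literature.NumberTheory.EllipticCurves.FineSelmerLimThm35AtTwoUpstairsProofs
import Literature.NumberTheory.GaloisRepresentations.TateLevelOneWildOdd
import HarnessLib

/-!
# `a₁ · a₂ = χ_cyc` for a Galois element acting by scalars on two cyclic components of `E[m]`
# (the Weil pairing's `det ρ̄_{E,m} = χ_m`, read on an eigen-decomposition) — proofs only

Topic `NumberTheory/EllipticCurves`.  Everything here is PROVED from tree theorems; no definition,
no named fact.  It is the reading of Silverman, *AEC* III.8, Prop. 8.1 + Cornell–Silverman–Stevens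
Ch. II §7 Proposition "`det ρ̄_m = χ_m`" (tree: `WeierstrassCurve.exists_weilPairing_holds`,
`Literature.NumberTheory.EllipticCurves.det_eq_modNCyclotomicCharacter`) that a consumer holding an
EIGEN-DECOMPOSITION of the torsion uses: if `σ ∈ Γ_F` acts on two points `g₁, g₂` spanning `E[m]` by
integer scalars `a₁, a₂` (`σ gᵢ = aᵢ gᵢ`), then `a₁ a₂ ≡ χ_m(σ) (mod m)`.  Printed proof, verbatim on the
pair `(g₁, g₂)` instead of a basis: `ζ := e_m(g₁, g₂)` is a PRIMITIVE `m`-th root of unity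
(non-degeneracy: `ζ^d = 1 ⟹ e_m(S, d g₂) = 1` for all `S` since `S ∈ ℤg₁ + ℤg₂` and `e_m` is
alternating, so `d g₂ = 0`, so `m = ord g₂ ∣ d`), and `σ ζ = e_m(σ g₁, σ g₂) = ζ^{a₁ a₂}` (bilinear,
Galois-equivariant) while `σ ζ = ζ^{χ_m(σ)}`.

* §1 `intCast_mul_eq_modNCyclotomicCharacter_of_smul_eq_zsmul` — the statement above, any level
  `m ≥ 2` invertible in the perfect field `F`, on `geomTorsion W m`.
* §2 `intCast_mul_eq_toZModPow_cyclotomicCharacter_of_cyclic_layers` — the same in the currency of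
  the `p`-adic cyclotomic character `χ_p = GaloisRep.cyclotomicCharacter F p` (`mod p^j`) and of two
  complementary subgroups `M₁ ⊓ M₂ = ⊥`, `M₁ ⊔ M₂ = ⊤` of the `p`-primary torsion
  `E[p^∞] = W.geomPrimaryTorsion p` with CYCLIC `p^j`-layers `Mᵢ ⊓ E[p^∞][p^j] = ℤ·gᵢ`
  (`addOrderOf g₂ = p^j`) — the shape printed for a CM curve at a split prime (Rubin, LNM 1716, §5
  Prop. 5.4 / Cor. 5.5: `E[p^∞] = E[𝔭^∞] ⊕ E[𝔭̄^∞]`, tree fact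
  `Deuring_galoisAction_cmPrimaryTorsion_split`, clause (cyc)): `σ gᵢ = aᵢ gᵢ ⟹ a₁ a₂ ≡ χ_p(σ) (mod p^j)`.
* §3 `p = 2`, layer `j = 2` (level `4`), characteristic `0`, `i² = −1`:
  **`σ • i = i ↔ a₁ a₂ ≡ 1 (mod 4)`** (`smul_sqrt_neg_one_eq_self_iff_intCast_mul_eq_one`),
  **`σ • i = −i ↔ a₁ a₂ ≡ −1 (mod 4)`** (`smul_sqrt_neg_one_eq_neg_iff_intCast_mul_eq_neg_one`) — the
  sign of `σ` on `F(i)` is the product of its signs on the two cyclic `4`-layers.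
* §4 (number field `F`) `intCast_mul_eq_one_of_mem_inertia_of_cyclic_layers` — for `τ` in an
  inertia group at a place `v ∤ p`: `a₁ a₂ ≡ 1 (mod p^j)` (the cyclotomic character is unramified away
  from `p`); at `p = 2`, layer `4`: `smul_eq_self_and_or_smul_eq_neg_and_of_mem_inertia_two` — `τ`
  fixes both layer generators or negates both.

Consumer (cell `bsd-print-cf2`, crux `stmt-BirchSwinnertonDyer-20368`, class line
«yager_twist_dictionary», (Q)-class recipe step (0) «`Υ ↠ Gal(K(E′₄)/K)`»): with
`Summit.….PrintCf2.HPrime.exists_mem_pairKer_smul_sqrt_neg_one_eq_neg` (some `τ ∈ Υ` moves `i`), §3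
gives a `τ ∈ Υ` whose sign pair on `E′[𝔭²] ⊕ E′[𝔭̄²]` has product `−1`.

## References

* [SilvermanAEC2009] J. H. Silverman, *The Arithmetic of Elliptic Curves*, 2nd ed., GTM 106 (2009),
  III.8, Prop. 8.1 (a)–(d), Cor. 8.1.1.
* [SilvermanCSS1997] J. H. Silverman, in Cornell–Silverman–Stevens, *Modular Forms and Fermat's Last
  Theorem* (1997), Ch. II §7 Proposition (`det ρ̄_m = χ_m`) and §8.
* [Rubin1999] K. Rubin, *Elliptic curves with complex multiplication and the conjecture of Birch and
  Swinnerton-Dyer*, LNM 1716 (1999), §5 Prop. 5.4, Cor. 5.5.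
* [Serre1968] J.-P. Serre, *Abelian ℓ-adic representations and elliptic curves* (1968), Ch. I §1.2.
-/

noncomputable section

open scoped Classical

universe u

open WeierstrassCurve NumberField IsDedekindDomain Literature.NumberTheory.GaloisRepresentations

namespace Literature.NumberTheory.EllipticCurves.WeilPairingCyclicComponents

/-! ## §0. Integer scalars on `m`-torsion reduce to natural scalars `mod m` -/

/-- In an additive group, if `m • T = 0` then `c • T = ((c : ZMod m).val) • T` for every `c : ℤ`
(`(c : ZMod m).val ≡ c (mod m)`). [folklore] -/
private theorem zsmul_eq_val_nsmul_of_nsmul_eq_zero {A : Type*} [AddCommGroup A] {m : ℕ} [NeZero m]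
    {T : A} (hT : m • T = 0) (c : ℤ) : c • T = ((c : ZMod m).val) • T := by
  have h1 : (((c : ZMod m).val : ℕ) : ℤ) + m * (c / m) = c := by
    rw [ZMod.val_intCast, Int.emod_add_mul_ediv]
  have hT' : (m : ℤ) • T = 0 := by rw [natCast_zsmul, hT]
  calc c • T = ((((c : ZMod m).val : ℕ) : ℤ) + m * (c / m)) • T := by rw [h1]
    _ = (((c : ZMod m).val : ℕ) : ℤ) • T + (c / m) • ((m : ℤ) • T) := by
        rw [add_zsmul, mul_comm, mul_smul]
    _ = ((c : ZMod m).val) • T := by rw [hT', smul_zero, add_zero, natCast_zsmul]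

/-- In an additive group, if `m • T = 0` and `a ≡ b (mod m)` then `a • T = b • T`. [folklore] -/
private theorem zsmul_eq_zsmul_of_intCast_eq {A : Type*} [AddCommGroup A] {m : ℕ} {T : A}
    (hT : m • T = 0) {a b : ℤ} (h : (a : ZMod m) = (b : ZMod m)) : a • T = b • T := by
  obtain ⟨k, hk⟩ := (ZMod.intCast_eq_intCast_iff_dvd_sub a b m).mp h
  have hb : b = a + m * k := by linear_combination hk
  have hT' : (m : ℤ) • T = 0 := by rw [natCast_zsmul, hT]
  rw [hb, add_zsmul, mul_comm, mul_smul, hT', smul_zero, add_zero]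

/-! ## §1. Two eigen-generators of `E[m]`: `a₁ a₂ = χ_m(σ)` -/

section LevelM

variable {F : Type u} [Field F] [PerfectField F] (W : WeierstrassCurve F) [W.IsElliptic]

/-- **`a₁ · a₂ ≡ χ_m(σ) (mod m)` when `σ` acts on two generators of `E[m]` by the scalars `a₁, a₂`.**
`W / F` elliptic over a perfect field, `m ≥ 2` with `(m : F) ≠ 0`; `g₁, g₂ ∈ E[m] = W.geomTorsion m`
with `E[m] = ℤ g₁ + ℤ g₂` (`hspan`) and `g₂` of exact order `m`; `σ ∈ Γ_F` with `σ • g₁ = a₁ • g₁`,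
`σ • g₂ = a₂ • g₂`.  Then `a₁ a₂ = χ_m(σ)` in `ℤ/m`, `χ_m = modNCyclotomicCharacter F m`.  Proof =
Cornell–Silverman–Stevens II §8 on the pair `(g₁, g₂)`: `ζ = e_m(g₁, g₂)` (tree Weil pairing
`exists_weilPairing_holds`) is a primitive `m`-th root of unity by non-degeneracy, and
`ζ^{χ_m(σ)} = σ ζ = e_m(σ g₁, σ g₂) = ζ^{a₁ a₂}`.
[cite: SilvermanCSS1997, Ch. II §7 Proposition and §8] [cite: SilvermanAEC2009, Prop. III.8.1] -/
theorem intCast_mul_eq_modNCyclotomicCharacter_of_smul_eq_zsmul (m : ℕ) [NeZero m] [NeZero (m : F)]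
    (hm : 2 ≤ m) {g₁ g₂ : geomTorsion W m}
    (hspan : ∀ T : geomTorsion W m, ∃ c₁ c₂ : ℤ, T = c₁ • g₁ + c₂ • g₂) (ho₂ : addOrderOf g₂ = m)
    (σ : Field.absoluteGaloisGroup F) {a₁ a₂ : ℤ} (ha₁ : σ • g₁ = a₁ • g₁) (ha₂ : σ • g₂ = a₂ • g₂) :
    ((a₁ * a₂ : ℤ) : ZMod m) = ((modNCyclotomicCharacter F m σ : (ZMod m)ˣ) : ZMod m) := by
  have hm0 : m ≠ 0 := NeZero.ne m
  obtain ⟨w, hpow, haddl, haddr, halt, hnd, hgal⟩ :=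
    exists_weilPairing_holds W m hm (NeZero.ne (m : F))
  -- values are nonzero; `w 0 T = 1`, `w S 0 = 1`; `w (a • S) T = w S T ^ a`, `w S (a • T) = …`
  have hne : ∀ S T, w S T ≠ 0 := fun S T h0 ↦ by
    have := hpow S T
    rw [h0, zero_pow hm0] at this
    exact zero_ne_one this
  have hzero_left : ∀ T, w 0 T = 1 := fun T ↦ by
    have h := haddl 0 0 T
    rw [add_zero] at h
    exact (mul_eq_left₀ (hne 0 T)).mp h.symm
  have hzero_right : ∀ S, w S 0 = 1 := fun S ↦ by
    have h := haddr S 0 0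
    rw [add_zero] at h
    exact (mul_eq_left₀ (hne S 0)).mp h.symm
  have hnsmul_left : ∀ (a : ℕ) S T, w (a • S) T = w S T ^ a := fun a S T ↦ by
    induction a with
    | zero => rw [zero_nsmul, pow_zero, hzero_left]
    | succ a ih => rw [succ_nsmul, haddl, ih, pow_succ]
  have hnsmul_right : ∀ (a : ℕ) S T, w S (a • T) = w S T ^ a := fun a S T ↦ by
    induction a with
    | zero => rw [zero_nsmul, pow_zero, hzero_right]
    | succ a ih => rw [succ_nsmul, haddr, ih, pow_succ]
  -- every `m`-torsion point is killed by `m`, so integer scalars reduce `mod m`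
  have htor : ∀ T : geomTorsion W m, m • T = 0 := fun T ↦ AddSubgroup.torsionBy.nsmul T
  have hspan' : ∀ T : geomTorsion W m, ∃ k₁ k₂ : ℕ, T = k₁ • g₁ + k₂ • g₂ := fun T ↦ by
    obtain ⟨c₁, c₂, hT⟩ := hspan T
    exact ⟨(c₁ : ZMod m).val, (c₂ : ZMod m).val, by
      rw [hT, zsmul_eq_val_nsmul_of_nsmul_eq_zero (htor g₁), zsmul_eq_val_nsmul_of_nsmul_eq_zero (htor g₂)]⟩
  -- `ζ = w g₁ g₂` is a primitive `m`-th root of unity, by non-degeneracy and `ord g₂ = m`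
  have hfin : IsOfFinOrder (w g₁ g₂) :=
    isOfFinOrder_iff_pow_eq_one.mpr ⟨m, Nat.pos_of_ne_zero hm0, hpow g₁ g₂⟩
  have hordζ : orderOf (w g₁ g₂) = m := by
    refine Nat.dvd_antisymm (orderOf_dvd_of_pow_eq_one (hpow g₁ g₂)) ?_
    set d := orderOf (w g₁ g₂) with hd
    have hdQ : d • g₂ = 0 := hnd (d • g₂) fun S ↦ by
      obtain ⟨k₁, k₂, hS⟩ := hspan' S
      rw [hS, hnsmul_right, haddl, hnsmul_left, hnsmul_left, halt g₂, one_pow, mul_one, ← pow_mul,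
        mul_comm, pow_mul, pow_orderOf_eq_one, one_pow]
    rw [← ho₂]
    exact addOrderOf_dvd_iff_nsmul_eq_zero.mpr hdQ
  -- `σ` acts on `g₁, g₂` by the natural scalars `nᵢ = aᵢ mod m`
  have hσ₁ : σ • g₁ = (a₁ : ZMod m).val • g₁ := by
    rw [ha₁, zsmul_eq_val_nsmul_of_nsmul_eq_zero (htor g₁)]
  have hσ₂ : σ • g₂ = (a₂ : ZMod m).val • g₂ := by
    rw [ha₂, zsmul_eq_val_nsmul_of_nsmul_eq_zero (htor g₂)]
  -- Galois equivariance versus the cyclotomic character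
  have hχ : σ • w g₁ g₂ = w g₁ g₂ ^ ((modNCyclotomicCharacter F m σ : (ZMod m)ˣ) : ZMod m).val :=
    modNCyclotomicCharacter_spec F m σ (w g₁ g₂) (hpow g₁ g₂)
  have hgalζ : σ • w g₁ g₂ = w g₁ g₂ ^ ((a₁ : ZMod m).val * (a₂ : ZMod m).val) := by
    rw [hgal σ g₁ g₂, hσ₁, hσ₂, hnsmul_left, hnsmul_right, ← pow_mul, mul_comm]
  rw [hχ, hfin.pow_eq_pow_iff_modEq, hordζ, ← ZMod.natCast_eq_natCast_iff] at hgalζ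
  push_cast at hgalζ
  simp only [ZMod.natCast_val, ZMod.cast_id', id_eq] at hgalζ
  rw [Int.cast_mul, hgalζ]

end LevelM

/-! ## §2. Complementary subgroups of `E[p^∞]` with cyclic `p^j`-layers -/

section Layers

variable {F : Type u} [Field F] [PerfectField F] (W : WeierstrassCurve F) [W.IsElliptic]
  (p : ℕ) [Fact p.Prime] [NeZero (p : F)]

/-- **`a₁ · a₂ ≡ χ_p(σ) (mod p^j)` on two complementary cyclic-layered components of `E[p^∞]`.**
`M₁, M₂ ≤ E[p^∞] = W.geomPrimaryTorsion p` with `M₁ ⊓ M₂ = ⊥`, `M₁ ⊔ M₂ = ⊤`, whose `p^j`-layers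
(`j ≠ 0`) are cyclic, `Mᵢ ⊓ E[p^∞][p^j] = ℤ·gᵢ`, with `addOrderOf g₂ = p^j` (the clause (cyc) of the
CM split-prime decomposition `E[p^∞] = E[𝔭^∞] ⊕ E[𝔭̄^∞]`, Rubin §5 Cor. 5.5); if `σ ∈ Γ_F` acts on the
layer generators by `σ • g₁ = a₁ • g₁`, `σ • g₂ = a₂ • g₂` (`aᵢ : ℤ`), then
`a₁ a₂ mod p^j = χ_p(σ) mod p^j`, where `χ_p = GaloisRep.cyclotomicCharacter F p` is the `p`-adic
cyclotomic character (`PadicInt.toZModPow j`).  (The layer generators span `E[p^j]`: `T = y₁ + y₂`,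
`yᵢ ∈ Mᵢ`, `p^j y₁ = −p^j y₂ ∈ M₁ ⊓ M₂ = 0`; then §1 at level `m = p^j` and
`χ_{p^j} = χ_p mod p^j`, tree `modNCyclotomicCharacter_eq_toZModPow_cyclotomicCharacter`.)
[cite: SilvermanCSS1997, Ch. II §7 Proposition and §8] [cite: Rubin1999, §5 Prop. 5.4, Cor. 5.5] -/
theorem intCast_mul_eq_toZModPow_cyclotomicCharacter_of_cyclic_layers
    (M₁ M₂ : AddSubgroup (W.geomPrimaryTorsion p)) (hinf : M₁ ⊓ M₂ = ⊥) (hsup : M₁ ⊔ M₂ = ⊤)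
    {j : ℕ} (hj : j ≠ 0) {g₁ g₂ : W.geomPrimaryTorsion p}
    (hg₁ : M₁ ⊓ AddSubgroup.torsionBy (W.geomPrimaryTorsion p) (p ^ j) = AddSubgroup.zmultiples g₁)
    (hg₂ : M₂ ⊓ AddSubgroup.torsionBy (W.geomPrimaryTorsion p) (p ^ j) = AddSubgroup.zmultiples g₂)
    (ho₂ : addOrderOf g₂ = p ^ j)
    (σ : Field.absoluteGaloisGroup F) {a₁ a₂ : ℤ} (ha₁ : σ • g₁ = a₁ • g₁) (ha₂ : σ • g₂ = a₂ • g₂) :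
    ((a₁ * a₂ : ℤ) : ZMod (p ^ j)) =
      PadicInt.toZModPow j ((GaloisRep.cyclotomicCharacter F p σ : ℤ_[p]ˣ) : ℤ_[p]) := by
  have hp : p.Prime := Fact.out
  haveI : NeZero (p ^ j) := ⟨pow_ne_zero _ hp.ne_zero⟩
  haveI : NeZero ((p ^ j : ℕ) : F) :=
    ⟨by rw [Nat.cast_pow]; exact pow_ne_zero _ (NeZero.ne (p : F))⟩
  have hm : 2 ≤ p ^ j := hp.two_le.trans (Nat.le_self_pow hj p)
  -- the generators lie in their layers: `gᵢ ∈ Mᵢ`, `p^j • gᵢ = 0`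
  have hg₁mem : g₁ ∈ M₁ ⊓ AddSubgroup.torsionBy (W.geomPrimaryTorsion p) (p ^ j) :=
    hg₁ ▸ AddSubgroup.mem_zmultiples g₁
  have hg₂mem : g₂ ∈ M₂ ⊓ AddSubgroup.torsionBy (W.geomPrimaryTorsion p) (p ^ j) :=
    hg₂ ▸ AddSubgroup.mem_zmultiples g₂
  have htor₁ : (p ^ j) • g₁ = 0 := AddSubgroup.torsionBy.nsmul_iff.mp (AddSubgroup.mem_inf.mp hg₁mem).2
  have htor₂ : (p ^ j) • g₂ = 0 := AddSubgroup.torsionBy.nsmul_iff.mp (AddSubgroup.mem_inf.mp hg₂mem).2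
  -- the generators as geometric `p^j`-torsion points `G₁, G₂ ∈ E[p^j]`
  have hG₁mem : (g₁ : W.geomPoints) ∈ geomTorsion W (p ^ j) := by
    refine AddSubgroup.torsionBy.nsmul_iff.mpr ?_
    rw [← AddSubmonoidClass.coe_nsmul, htor₁, ZeroMemClass.coe_zero]
  have hG₂mem : (g₂ : W.geomPoints) ∈ geomTorsion W (p ^ j) := by
    refine AddSubgroup.torsionBy.nsmul_iff.mpr ?_
    rw [← AddSubmonoidClass.coe_nsmul, htor₂, ZeroMemClass.coe_zero]
  obtain ⟨G₁, hG₁⟩ : ∃ G : geomTorsion W (p ^ j), (G : W.geomPoints) = g₁ := ⟨⟨_, hG₁mem⟩, rfl⟩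
  obtain ⟨G₂, hG₂⟩ : ∃ G : geomTorsion W (p ^ j), (G : W.geomPoints) = g₂ := ⟨⟨_, hG₂mem⟩, rfl⟩
  -- spanning: `E[p^j] = ℤ g₁ + ℤ g₂`
  have hspan : ∀ T : geomTorsion W (p ^ j), ∃ c₁ c₂ : ℤ, T = c₁ • G₁ + c₂ • G₂ := by
    intro T
    have hTtor : (p ^ j) • (T : W.geomPoints) = 0 := AddSubgroup.torsionBy.nsmul_iff.mp T.2
    have hTprim : (T : W.geomPoints) ∈ W.geomPrimaryTorsion p := ⟨j, hTtor⟩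
    obtain ⟨x, hx⟩ : ∃ x : W.geomPrimaryTorsion p, (x : W.geomPoints) = T := ⟨⟨_, hTprim⟩, rfl⟩
    have hxmem : x ∈ M₁ ⊔ M₂ := hsup ▸ AddSubgroup.mem_top x
    obtain ⟨y₁, hy₁, y₂, hy₂, hxy⟩ := AddSubgroup.mem_sup.mp hxmem
    have hxtor : (p ^ j) • x = 0 :=
      Subtype.ext (by rw [AddSubmonoidClass.coe_nsmul, ZeroMemClass.coe_zero, hx]; exact hTtor)
    -- `p^j y₁ = -(p^j y₂)` lies in `M₁ ⊓ M₂ = ⊥`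
    have hsum : (p ^ j) • y₁ + (p ^ j) • y₂ = 0 := by rw [← smul_add, hxy, hxtor]
    have hy₁tor : (p ^ j) • y₁ = 0 := by
      have h1 : (p ^ j) • y₁ ∈ M₁ ⊓ M₂ := by
        refine AddSubgroup.mem_inf.mpr ⟨M₁.nsmul_mem hy₁ _, ?_⟩
        rw [eq_neg_of_add_eq_zero_left hsum]
        exact M₂.neg_mem (M₂.nsmul_mem hy₂ _)
      rw [hinf] at h1
      exact (AddSubgroup.mem_bot).mp h1
    have hy₂tor : (p ^ j) • y₂ = 0 := by rwa [hy₁tor, zero_add] at hsum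
    have hy₁mem : y₁ ∈ M₁ ⊓ AddSubgroup.torsionBy (W.geomPrimaryTorsion p) (p ^ j) :=
      AddSubgroup.mem_inf.mpr ⟨hy₁, AddSubgroup.torsionBy.nsmul_iff.mpr hy₁tor⟩
    have hy₂mem : y₂ ∈ M₂ ⊓ AddSubgroup.torsionBy (W.geomPrimaryTorsion p) (p ^ j) :=
      AddSubgroup.mem_inf.mpr ⟨hy₂, AddSubgroup.torsionBy.nsmul_iff.mpr hy₂tor⟩
    rw [hg₁, AddSubgroup.mem_zmultiples_iff] at hy₁mem
    rw [hg₂, AddSubgroup.mem_zmultiples_iff] at hy₂mem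
    obtain ⟨c₁, rfl⟩ := hy₁mem
    obtain ⟨c₂, rfl⟩ := hy₂mem
    refine ⟨c₁, c₂, Subtype.ext ?_⟩
    have h := congrArg Subtype.val hxy
    simp only [AddSubgroup.coe_add, AddSubgroupClass.coe_zsmul] at h
    rw [AddSubgroup.coe_add, AddSubgroupClass.coe_zsmul, AddSubgroupClass.coe_zsmul, hG₁, hG₂, h, hx]
  -- order of `G₂` and the action of `σ` on `G₁, G₂`
  have hoG₂ : addOrderOf G₂ = p ^ j := by
    have h1 : addOrderOf (G₂ : W.geomPoints) = addOrderOf G₂ :=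
      addOrderOf_injective (geomTorsion W (p ^ j)).subtype Subtype.val_injective G₂
    have h2 : addOrderOf (g₂ : W.geomPoints) = addOrderOf g₂ :=
      addOrderOf_injective (W.geomPrimaryTorsion p).subtype Subtype.val_injective g₂
    rw [← h1, hG₂, h2, ho₂]
  have hσ₁ : σ • G₁ = a₁ • G₁ := by
    apply Subtype.ext
    rw [AddSubgroup.torsionBy.coe_smul, AddSubgroupClass.coe_zsmul, hG₁, ← primaryComponent.coe_smul, ha₁,
      AddSubgroupClass.coe_zsmul]
  have hσ₂ : σ • G₂ = a₂ • G₂ := by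
    apply Subtype.ext
    rw [AddSubgroup.torsionBy.coe_smul, AddSubgroupClass.coe_zsmul, hG₂, ← primaryComponent.coe_smul, ha₂,
      AddSubgroupClass.coe_zsmul]
  rw [← modNCyclotomicCharacter_eq_toZModPow_cyclotomicCharacter F p j σ]
  exact intCast_mul_eq_modNCyclotomicCharacter_of_smul_eq_zsmul W (p ^ j) hm hspan hoG₂ σ hσ₁ hσ₂

end Layers

/-! ## §3. `p = 2`, layer `j = 2`: the sign of `σ` on `i` is the product of its signs on the two `4`-layers -/

section Two

variable {F : Type} [Field F] [CharZero F] (W : WeierstrassCurve F) [W.IsElliptic]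

/-- Units of `ℤ/4` are `±1`. [folklore] -/
private theorem units_zmod_four (u : (ZMod (2 ^ 2))ˣ) :
    (u : ZMod (2 ^ 2)) = 1 ∨ (u : ZMod (2 ^ 2)) = -1 := by
  revert u
  decide

/-- **`σ • i = i ↔ a₁ a₂ ≡ 1 (mod 4)`** (`i² = −1`, characteristic `0`): for two complementary components
of `E[2^∞]` with cyclic `4`-layers `ℤ·g₁`, `ℤ·g₂` (`ord g₂ = 4`) on which `σ` acts by `a₁`, `a₂`,
`σ` fixes `i` iff the product of its two layer scalars is `1 mod 4` (§2 at `p = 2`, `j = 2`, and the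
tree's `FineSelmerUpstairs.smul_eq_self_iff_toZModPow_two_cyclotomicCharacter_eq_one`).
[cite: SilvermanCSS1997, Ch. II §7 Proposition and §8] [cite: Serre1968, Ch. I §1.2] -/
theorem smul_sqrt_neg_one_eq_self_iff_intCast_mul_eq_one
    (M₁ M₂ : AddSubgroup (W.geomPrimaryTorsion 2)) (hinf : M₁ ⊓ M₂ = ⊥) (hsup : M₁ ⊔ M₂ = ⊤)
    {g₁ g₂ : W.geomPrimaryTorsion 2}
    (hg₁ : M₁ ⊓ AddSubgroup.torsionBy (W.geomPrimaryTorsion 2) (2 ^ 2) = AddSubgroup.zmultiples g₁)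
    (hg₂ : M₂ ⊓ AddSubgroup.torsionBy (W.geomPrimaryTorsion 2) (2 ^ 2) = AddSubgroup.zmultiples g₂)
    (ho₂ : addOrderOf g₂ = 2 ^ 2)
    (σ : Field.absoluteGaloisGroup F) {a₁ a₂ : ℤ} (ha₁ : σ • g₁ = a₁ • g₁) (ha₂ : σ • g₂ = a₂ • g₂)
    {i : AlgebraicClosure F} (hi : i ^ 2 = -1) :
    σ • i = i ↔ ((a₁ * a₂ : ℤ) : ZMod (2 ^ 2)) = 1 := by
  haveI : Fact (Nat.Prime 2) := ⟨Nat.prime_two⟩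
  haveI : NeZero ((2 : ℕ) : F) := ⟨by exact_mod_cast (two_ne_zero : (2 : F) ≠ 0)⟩
  rw [intCast_mul_eq_toZModPow_cyclotomicCharacter_of_cyclic_layers W 2 M₁ M₂ hinf hsup two_ne_zero hg₁ hg₂
    ho₂ σ ha₁ ha₂]
  exact FineSelmerUpstairs.smul_eq_self_iff_toZModPow_two_cyclotomicCharacter_eq_one i hi σ

/-- **`σ • i = −i ↔ a₁ a₂ ≡ −1 (mod 4)`** (`i² = −1`, characteristic `0`): `σ • i = ±i` always,
`a₁ a₂ mod 4 = χ₂(σ) mod 4` is a unit `±1` of `ℤ/4`, and `σ • i = i ↔ a₁ a₂ ≡ 1 (mod 4)`.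
[cite: SilvermanCSS1997, Ch. II §7 Proposition and §8] [cite: Serre1968, Ch. I §1.2] -/
theorem smul_sqrt_neg_one_eq_neg_iff_intCast_mul_eq_neg_one
    (M₁ M₂ : AddSubgroup (W.geomPrimaryTorsion 2)) (hinf : M₁ ⊓ M₂ = ⊥) (hsup : M₁ ⊔ M₂ = ⊤)
    {g₁ g₂ : W.geomPrimaryTorsion 2}
    (hg₁ : M₁ ⊓ AddSubgroup.torsionBy (W.geomPrimaryTorsion 2) (2 ^ 2) = AddSubgroup.zmultiples g₁)
    (hg₂ : M₂ ⊓ AddSubgroup.torsionBy (W.geomPrimaryTorsion 2) (2 ^ 2) = AddSubgroup.zmultiples g₂)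
    (ho₂ : addOrderOf g₂ = 2 ^ 2)
    (σ : Field.absoluteGaloisGroup F) {a₁ a₂ : ℤ} (ha₁ : σ • g₁ = a₁ • g₁) (ha₂ : σ • g₂ = a₂ • g₂)
    {i : AlgebraicClosure F} (hi : i ^ 2 = -1) :
    σ • i = -i ↔ ((a₁ * a₂ : ℤ) : ZMod (2 ^ 2)) = -1 := by
  haveI : Fact (Nat.Prime 2) := ⟨Nat.prime_two⟩
  haveI : NeZero ((2 : ℕ) : F) := ⟨by exact_mod_cast (two_ne_zero : (2 : F) ≠ 0)⟩
  have hfix := smul_sqrt_neg_one_eq_self_iff_intCast_mul_eq_one W M₁ M₂ hinf hsup hg₁ hg₂ ho₂ σ ha₁ ha₂ hi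
  -- `a₁ a₂ mod 4` is a unit of `ℤ/4`, i.e. `±1`
  have hunit : ((a₁ * a₂ : ℤ) : ZMod (2 ^ 2)) = 1 ∨ ((a₁ * a₂ : ℤ) : ZMod (2 ^ 2)) = -1 := by
    rw [intCast_mul_eq_toZModPow_cyclotomicCharacter_of_cyclic_layers W 2 M₁ M₂ hinf hsup two_ne_zero hg₁
      hg₂ ho₂ σ ha₁ ha₂]
    obtain ⟨u, hu⟩ := ((GaloisRep.cyclotomicCharacter F 2 σ).isUnit).map (PadicInt.toZModPow 2)
    rw [← hu]
    exact units_zmod_four u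
  -- `σ • i` is a square root of `-1`, hence `= ± i`, and `i ≠ -i`
  have hi0 : i ≠ 0 := by
    rintro rfl
    norm_num at hi
  have hsq : (σ • i) ^ 2 = -1 := by rw [pow_two, ← smul_mul', ← pow_two, hi, smul_neg, smul_one]
  have hpm : σ • i = i ∨ σ • i = -i := by
    have h : (σ • i - i) * (σ • i + i) = 0 := by linear_combination hsq - hi
    rcases mul_eq_zero.mp h with h | h
    · exact Or.inl (sub_eq_zero.mp h)
    · exact Or.inr (eq_neg_of_add_eq_zero_left h)
  have hne : -i ≠ i := fun h ↦ by
    have h2 : (2 : AlgebraicClosure F) * i = 0 := by linear_combination -h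
    exact hi0 ((mul_eq_zero.mp h2).resolve_left two_ne_zero)
  have h13 : (-1 : ZMod (2 ^ 2)) ≠ 1 := by decide
  constructor
  · intro h
    rcases hunit with h1 | h1
    · exact absurd ((hfix.mpr h1).symm.trans h) hne.symm
    · exact h1
  · intro h
    rcases hpm with h1 | h1
    · exact absurd ((hfix.mp h1).symm.trans h) h13.symm
    · exact h1

end Two

/-! ## §4. Inertia away from `p` acts on the two components with product-one scalars -/

section Inertia

variable {F : Type u} [Field F] [NumberField F] (W : WeierstrassCurve F) [W.IsElliptic]
  (p : ℕ) [Fact p.Prime]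

/-- **`a₁ · a₂ ≡ 1 (mod p^j)` for an INERTIA element away from `p`.**  Over a number field `F`, with
`M₁, M₂ ≤ E[p^∞]` complementary with cyclic `p^j`-layers `ℤ·g₁`, `ℤ·g₂` (`ord g₂ = p^j`, `j ≠ 0`) as in
§2: if `τ` lies in an inertia group `I_𝔓 ≤ Γ_F` at a prime `𝔓` of `\bar ℤ_F` above a finite place
`v ∤ p` and acts on the layer generators by `τ • gᵢ = aᵢ • gᵢ`, then `a₁ a₂ ≡ 1 (mod p^j)` — §2 and
the `p`-adic cyclotomic character is unramified away from `p` (`σ ∈ I_𝔓` fixes every `p`-power root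
of unity, tree `smul_eq_self_of_mem_inertia_of_pow_prime_pow_eq_one`; Serre, *Abelian ℓ-adic
representations*, I §1.2). [cite: SilvermanCSS1997, Ch. II §7 Proposition and §8] [cite: Serre1968, Ch. I §1.2] -/
theorem intCast_mul_eq_one_of_mem_inertia_of_cyclic_layers
    (M₁ M₂ : AddSubgroup (W.geomPrimaryTorsion p)) (hinf : M₁ ⊓ M₂ = ⊥) (hsup : M₁ ⊔ M₂ = ⊤)
    {j : ℕ} (hj : j ≠ 0) {g₁ g₂ : W.geomPrimaryTorsion p}
    (hg₁ : M₁ ⊓ AddSubgroup.torsionBy (W.geomPrimaryTorsion p) (p ^ j) = AddSubgroup.zmultiples g₁)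
    (hg₂ : M₂ ⊓ AddSubgroup.torsionBy (W.geomPrimaryTorsion p) (p ^ j) = AddSubgroup.zmultiples g₂)
    (ho₂ : addOrderOf g₂ = p ^ j)
    {v : HeightOneSpectrum (𝓞 F)} (hv : (p : 𝓞 F) ∉ v.asIdeal)
    {𝔓 : Ideal (absIntegers (𝓞 F) F)} (h𝔓 : 𝔓 ∈ v.primesAbove)
    {τ : Field.absoluteGaloisGroup F} (hτ : τ ∈ 𝔓.inertia (Field.absoluteGaloisGroup F))
    {a₁ a₂ : ℤ} (ha₁ : τ • g₁ = a₁ • g₁) (ha₂ : τ • g₂ = a₂ • g₂) :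
    ((a₁ * a₂ : ℤ) : ZMod (p ^ j)) = 1 := by
  have hp : p.Prime := Fact.out
  haveI : NeZero ((p : ℕ) : F) := ⟨Nat.cast_ne_zero.mpr hp.ne_zero⟩
  have hχ : GaloisRep.cyclotomicCharacter F p τ = 1 := by
    rw [GaloisRep.cyclotomicCharacter_apply]
    exact cyclotomicCharacter_eq_one_of_forall_pow_eq_one p _ fun _ _ ht ↦
      smul_eq_self_of_mem_inertia_of_pow_prime_pow_eq_one hv h𝔓 hτ ht
  rw [intCast_mul_eq_toZModPow_cyclotomicCharacter_of_cyclic_layers W p M₁ M₂ hinf hsup hj hg₁ hg₂ ho₂ τ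
    ha₁ ha₂, hχ, Units.val_one, map_one]

/-- **Inertia away from `2` acts on the two cyclic `4`-layers with the SAME sign**: at `p = 2`, layer
`j = 2`, for `τ ∈ I_𝔓`, `𝔓 ∣ v ∤ 2`: either `τ` fixes both layer generators `g₁, g₂`, or `τ gᵢ = −gᵢ`
for both (`a₁ a₂ ≡ 1 (mod 4)` and `aᵢ` odd).  With a non-triviality input (e.g. Néron–Ogg–Shafarevich at
a place of bad reduction, tree `WeierstrassCurve.exists_galoisRepTate_ne_one_of_mem_badPlaces`) this is
the pattern "`τ` acts as `−1` on `E[𝔭²] ⊕ E[𝔭̄²]`".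
[cite: SilvermanCSS1997, Ch. II §7 Proposition and §8] [cite: Serre1968, Ch. I §1.2] -/
theorem smul_eq_self_and_or_smul_eq_neg_and_of_mem_inertia_two
    (M₁ M₂ : AddSubgroup (W.geomPrimaryTorsion 2)) (hinf : M₁ ⊓ M₂ = ⊥) (hsup : M₁ ⊔ M₂ = ⊤)
    {g₁ g₂ : W.geomPrimaryTorsion 2}
    (hg₁ : M₁ ⊓ AddSubgroup.torsionBy (W.geomPrimaryTorsion 2) (2 ^ 2) = AddSubgroup.zmultiples g₁)
    (hg₂ : M₂ ⊓ AddSubgroup.torsionBy (W.geomPrimaryTorsion 2) (2 ^ 2) = AddSubgroup.zmultiples g₂)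
    (ho₂ : addOrderOf g₂ = 2 ^ 2)
    {v : HeightOneSpectrum (𝓞 F)} (hv : (2 : 𝓞 F) ∉ v.asIdeal)
    {𝔓 : Ideal (absIntegers (𝓞 F) F)} (h𝔓 : 𝔓 ∈ v.primesAbove)
    {τ : Field.absoluteGaloisGroup F} (hτ : τ ∈ 𝔓.inertia (Field.absoluteGaloisGroup F))
    {a₁ a₂ : ℤ} (ha₁ : τ • g₁ = a₁ • g₁) (ha₂ : τ • g₂ = a₂ • g₂) :
    (τ • g₁ = g₁ ∧ τ • g₂ = g₂) ∨ (τ • g₁ = -g₁ ∧ τ • g₂ = -g₂) := by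
  haveI : Fact (Nat.Prime 2) := ⟨Nat.prime_two⟩
  have hv' : ((2 : ℕ) : 𝓞 F) ∉ v.asIdeal := by exact_mod_cast hv
  have hprod := intCast_mul_eq_one_of_mem_inertia_of_cyclic_layers W 2 M₁ M₂ hinf hsup two_ne_zero hg₁ hg₂
    ho₂ hv' h𝔓 hτ ha₁ ha₂
  rw [Int.cast_mul] at hprod
  -- the layer generators are killed by `4`
  have htor₁ : (2 ^ 2) • g₁ = 0 :=
    AddSubgroup.torsionBy.nsmul_iff.mp (AddSubgroup.mem_inf.mp (hg₁ ▸ AddSubgroup.mem_zmultiples g₁)).2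
  have htor₂ : (2 ^ 2) • g₂ = 0 :=
    AddSubgroup.torsionBy.nsmul_iff.mp (AddSubgroup.mem_inf.mp (hg₂ ▸ AddSubgroup.mem_zmultiples g₂)).2
  -- in `ℤ/4`, `x y = 1` forces `x = y = 1` or `x = y = -1`
  have key : ∀ x y : ZMod (2 ^ 2), x * y = 1 → (x = 1 ∧ y = 1) ∨ (x = -1 ∧ y = -1) := by decide
  rcases key _ _ hprod with ⟨h1, h2⟩ | ⟨h1, h2⟩
  · refine Or.inl ⟨?_, ?_⟩
    · rw [ha₁, zsmul_eq_zsmul_of_intCast_eq htor₁ (b := 1) (by rw [h1, Int.cast_one]), one_zsmul]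
    · rw [ha₂, zsmul_eq_zsmul_of_intCast_eq htor₂ (b := 1) (by rw [h2, Int.cast_one]), one_zsmul]
  · refine Or.inr ⟨?_, ?_⟩
    · rw [ha₁, zsmul_eq_zsmul_of_intCast_eq htor₁ (b := -1) (by rw [h1, Int.cast_neg, Int.cast_one]),
        neg_one_zsmul]
    · rw [ha₂, zsmul_eq_zsmul_of_intCast_eq htor₂ (b := -1) (by rw [h2, Int.cast_neg, Int.cast_one]),
        neg_one_zsmul]

end Inertia

end Literature.NumberTheory.EllipticCurves.WeilPairingCyclicComponents

end
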